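import Literature.NumberTheory.Transcendental.CurvePeriodsEllipticEndgameProofs
import Literature.NumberTheory.Transcendental.SemistabilityInduction
import Literature.NumberTheory.Transcendental.PhilipponZeroEstimateStdProofs
import HarnessLib

/-!
# Periods of curve type: genus `0` and closed paths on a non-CM elliptic curve — UNCONDITIONAL

Companion of `Literature/NumberTheory/Transcendental/CurvePeriods.lean` (Huber–Wüstholz 2022,
Thm. 13.3 (2) = Kontsevich's period conjecture for periods of curve type, rendered on explicit
period symbols `(Z, ω, γ)` with the elementary relations (R1)–(R5); general statement: the named
fact `HuberWustholzCurvePeriods`) and of `CurvePeriodsEllipticEndgameProofs.lean`, whose theorems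
take Wüstholz's analytic subgroup theorem at period vectors,
`analyticSubgroupTheorem_GaGmE_periods`, as a hypothesis. That named fact is now a theorem of the
tree (`analyticSubgroupTheorem_GaGmE_periods_of_philippon` of `SemistabilityInduction.lean`
applied to the discharged zero estimate `philippon1986_std_holds` of
`PhilipponZeroEstimateStdProofs.lean`), so the following case of Theorem 13.3 (2) is PROVED
outright, with Baker's theorem, Wüstholz's analytic subgroup theorem for `𝔾ₐ × 𝔾ₘ^ι × (E♮)²` at
period vectors and Philippon's zero estimate as its (formalized) transcendence input:

* `huberWustholzCurvePeriods_ellipticLoops_puncturedLine` — for a lattice `Λ` with algebraic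
  invariants `g₂, g₃` and without complex multiplication, every vanishing `ℚ̄`-linear
  combination of period symbols supported on CLOSED paths of the affine Weierstrass curve
  `E_L : y² = x³ − (g₂/4)x − g₃/4`, on the punctured lines `Z_a = {y ∏ᵢ (x − aᵢ) = 1}`
  (`a : Fin r → ℚ̄` injective), on `𝔾ₘ = {xy = 1}` and on `𝔸¹` (arbitrary `C¹` paths with algebraic
  end points on the last three) is a `ℚ̄`-linear combination of the elementary relations
  (R1)–(R5). The periods concerned are the `ℚ̄`-linear combinations of `1`, `ω₁, ω₂, η₁, η₂` and
  logarithms of algebraic numbers (book §13.2: "elliptic curves"; Thm. 15.3 (1)).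
* `huberWustholzCurvePeriods_ellipticLoops` — the same without punctured lines (support on
  `E_L`-loops, `𝔾ₘ`, `𝔸¹`).

What is NOT here: open paths on `E_L`, CM curves, several curves, genus `≥ 2` — the general named
fact `HuberWustholzCurvePeriods` (see `CurvePeriodsEllipticEndgameProofs.lean`).

## References

* A. Huber, G. Wüstholz, *Transcendence and Linear Relations of 1-Periods*, Cambridge Tracts in
  Mathematics 227, CUP 2022 [HuberWustholz2022]: Thm. 13.3 (2) (p. 121 of the held text), §13.2
  and Thm. 13.9 (pp. 122–125), Thm. 15.3 (1), §18.1 (p. 160), Thm. 6.2.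
* G. Wüstholz, Ann. of Math. 129 (1989), 501–517 (analytic subgroup theorem). [Wustholz1989]
* P. Philippon, Bull. Soc. Math. France 114 (1986), 355–383, Thm. 2.1. [Philippon1986]
* A. Baker, *Transcendental Number Theory*, CUP 1975, Thm. 2.1. [Baker1975]
-/

noncomputable section

open MvPolynomial

namespace Literature.NumberTheory.Transcendental

namespace CurvePeriods

/-- **Huber–Wüstholz, Theorem 13.3 (2), for closed paths on a non-CM elliptic curve together with
`𝔾ₘ` and `𝔸¹` — PROVED.** [cite: HuberWustholz2022, Thm. 13.3 (2) (p. 121), §13.2, Thm. 15.3 (1)] -/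
theorem huberWustholzCurvePeriods_ellipticLoops
    (L : PeriodPair) (h₂ : IsAlgebraic ℚ L.g₂) (h₃ : IsAlgebraic ℚ L.g₃) (hCM : ¬ L.HasCM)
    (c : PeriodSymbol →₀ ℂ) (hc : ∀ s, IsAlgebraic ℚ (c s))
    (hsupp : ∀ s ∈ c.support,
      (s.Z = Ell.curve L ∧ s.γ.toFun 1 = s.γ.toFun 0) ∨
        s.Z = (⟨2, 1, ![X 0 * X 1 - 1]⟩ : CurveData) ∨ s.Z = CurveData.affineLine)
    (h0 : evalCombination c = 0) :
    ∃ (k : ℕ) (ρ : Fin k → (PeriodSymbol →₀ ℂ)) (a : Fin k → ℂ),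
      (∀ l, IsElementaryRelation (ρ l)) ∧ (∀ l, IsAlgebraic ℚ (a l)) ∧ c = ∑ l, a l • ρ l :=
  huberWustholzCurvePeriods_of_ellipticLoops
    (analyticSubgroupTheorem_GaGmE_periods_of_philippon philippon1986_std_holds) L h₂ h₃ hCM c hc
    hsupp h0

/-- **Huber–Wüstholz, Theorem 13.3 (2), for genus `0` (punctured lines, `𝔾ₘ`, `𝔸¹`, arbitrary
paths) together with closed paths on a non-CM elliptic curve — PROVED.**
[cite: HuberWustholz2022, Thm. 13.3 (2) (p. 121), §13.2, Thm. 15.3 (1)] -/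
theorem huberWustholzCurvePeriods_ellipticLoops_puncturedLine
    (L : PeriodPair) (h₂ : IsAlgebraic ℚ L.g₂) (h₃ : IsAlgebraic ℚ L.g₃) (hCM : ¬ L.HasCM)
    (c : PeriodSymbol →₀ ℂ) (hc : ∀ s, IsAlgebraic ℚ (c s))
    (hsupp : ∀ s ∈ c.support,
      (∃ (r : ℕ) (a : Fin r → ℂ), Function.Injective a ∧ (∀ i, IsAlgebraic ℚ (a i)) ∧
        s.Z = (⟨2, 1, ![X 1 * ∏ i, (X 0 - C (a i)) - 1]⟩ : CurveData)) ∨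
      (s.Z = Ell.curve L ∧ s.γ.toFun 1 = s.γ.toFun 0) ∨
        s.Z = (⟨2, 1, ![X 0 * X 1 - 1]⟩ : CurveData) ∨ s.Z = CurveData.affineLine)
    (h0 : evalCombination c = 0) :
    ∃ (k : ℕ) (ρ : Fin k → (PeriodSymbol →₀ ℂ)) (a : Fin k → ℂ),
      (∀ l, IsElementaryRelation (ρ l)) ∧ (∀ l, IsAlgebraic ℚ (a l)) ∧ c = ∑ l, a l • ρ l :=
  huberWustholzCurvePeriods_of_puncturedLine_or_ellipticLoops
    (analyticSubgroupTheorem_GaGmE_periods_of_philippon philippon1986_std_holds) L h₂ h₃ hCM c hc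
    hsupp h0

end CurvePeriods

end Literature.NumberTheory.Transcendental

end
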